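import Mathlib
import Summits.MatrixMultiplication.MatrixMultiplication.Theses.HiddenToeplitzCorners
import Summits.MatrixMultiplication.MatrixMultiplication.Theorems.HiddenCorners.Negative.KroneckerNeutralCore

/-!
# Kronecker pencils are ω-neutral in every basis — the matrix theorem and the crux's literal form
(crux `HiddenCorners`, stmt-MatrixMultiplication-7492, line `birth`; paper: `Cruxes/HiddenCorners/KroneckerNeutral.md` Thm 1)

* `kroneckerPencil_le_width_succ` — for `P, Q` invertible on `Fin r × Fin n` and any `S` all of whose eigenspaces
  have dimension `≤ 1`: if every `P (E_ab ⊗ 1ₙ) Q` satisfies `T_ab − Sᵀ T_ab S = G₀ H₁(ab)ᵀ + G₁(ab) H₀ᵀ` with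
  generators of width `d`, then `r ≤ d + 1` (rectangle identity + the abstract `core` of the Core file).
* `finrank_eigenspace_shiftZT_le_one` — the crux's transposed lower shift `Zᵀ` on `Fin N` has all eigenspaces of
  dimension `≤ 1` (a solution of `Zᵀ v = μ v` is determined by `v 0`).
* `kroneckerPencil_crux_le_width_succ` — the crux's literal split Stein identity `T − Z T Zᵀ = …` on `Fin N`, for
  `T_ab = P · reindex e e (E_ab ⊗ 1ₙ) · Q` with any presentation `e : Fin r × Fin n ≃ Fin N`: `r ≤ d + 1`.
So the card's flagship family realises the ω-neutral law exactly (row-major `X ⊗ 1_r` has width `r`) and can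
never witness `stub_adjugate_family` / `HiddenCorners` at `d ≤ r − 2`, whatever the bases.
-/

set_option linter.dupNamespace false

namespace Summit.MatrixMultiplication.MatrixMultiplication.Theorems.KroneckerNeutral

open scoped BigOperators Matrix Kronecker

variable {r n : ℕ}

/-- The Kronecker coefficient matrix `E_ab ⊗ 1ₙ` applied to a vector. -/
theorem kron_single_one_mulVec (a b : Fin r) (v : Fin r × Fin n → ℂ) (c : Fin r) (i : Fin n) :
    ((Matrix.single a b (1 : ℂ) ⊗ₖ (1 : Matrix (Fin n) (Fin n) ℂ)) *ᵥ v) (c, i)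
      = if c = a then v (b, i) else 0 := by
  simp only [Matrix.mulVec, dotProduct, Matrix.kroneckerMap_apply, Fintype.sum_prod_type]
  by_cases hc : c = a
  · subst hc
    simp only [if_true]
    rw [Finset.sum_eq_single b]
    · rw [Finset.sum_eq_single i]
      · simp
      · intro j _ hj
        simp [Ne.symm hj]
      · simp
    · intro b' _ hb'
      apply Finset.sum_eq_zero
      intro j _
      simp [Matrix.single, Ne.symm hb']
    · simp
  · simp only [hc, if_false]
    apply Finset.sum_eq_zero
    intro b' _
    apply Finset.sum_eq_zero
    intro j _
    simp [Matrix.single, Ne.symm hc]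

/-- The pairing `u ⬝ (E_ab ⊗ 1ₙ) v = Σ_i u(a,i) v(b,i)` (entry `(a,b)` of `u_mat v_matᵀ`). -/
theorem kron_pairing (a b : Fin r) (u v : Fin r × Fin n → ℂ) :
    u ⬝ᵥ ((Matrix.single a b (1 : ℂ) ⊗ₖ (1 : Matrix (Fin n) (Fin n) ℂ)) *ᵥ v)
      = ∑ i : Fin n, u (a, i) * v (b, i) := by
  simp only [dotProduct, Fintype.sum_prod_type]
  simp only [kron_single_one_mulVec]
  rw [Finset.sum_eq_single a]
  · simp
  · intro c _ hc; simp [hc]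
  · simp

/-- Kernel of a `d`-column matrix transposed has codimension `≤ d`. -/
theorem finrank_ker_transpose_ge {ι : Type*} [Fintype ι] (d : ℕ) (G : Matrix ι (Fin d) ℂ) :
    Fintype.card ι ≤ Module.finrank ℂ (LinearMap.ker (Matrix.mulVecLin Gᵀ)) + d := by
  have h := LinearMap.finrank_range_add_finrank_ker (Matrix.mulVecLin Gᵀ)
  have hr : Module.finrank ℂ (LinearMap.range (Matrix.mulVecLin Gᵀ)) ≤ d := by
    have := Matrix.rank_le_card_height Gᵀ
    simpa [Matrix.rank, Fintype.card_fin] using this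
  rw [Module.finrank_fintype_fun_eq_card] at h
  omega

/-- **Theorem 1 of KroneckerNeutral.md (abstract displacement operator).**  If every coefficient matrix
`P (E_ab ⊗ 1ₙ) Q` of the Kronecker pencil has a split `S`-displacement of width `d`, with `P, Q` invertible and
all eigenspaces of `S` of dimension `≤ 1`, then `r ≤ d + 1`. -/
theorem kroneckerPencil_le_width_succ (d : ℕ) (hn : 1 ≤ n)
    (P Q S : Matrix (Fin r × Fin n) (Fin r × Fin n) ℂ) (hP : IsUnit P) (hQ : IsUnit Q)
    (hS : ∀ μ : ℂ, Module.finrank ℂ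
      (LinearMap.ker (Matrix.toLin' S - μ • (LinearMap.id : (Fin r × Fin n → ℂ) →ₗ[ℂ] _))) ≤ 1)
    (G₀ H₀ : Matrix (Fin r × Fin n) (Fin d) ℂ) (G₁ H₁ : Fin r → Fin r → Matrix (Fin r × Fin n) (Fin d) ℂ)
    (hdisp : ∀ a b : Fin r,
      P * (Matrix.single a b (1 : ℂ) ⊗ₖ (1 : Matrix (Fin n) (Fin n) ℂ)) * Q
        - Sᵀ * (P * (Matrix.single a b (1 : ℂ) ⊗ₖ (1 : Matrix (Fin n) (Fin n) ℂ)) * Q) * S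
        = G₀ * (H₁ a b)ᵀ + G₁ a b * H₀ᵀ) :
    r ≤ d + 1 := by
  classical
  set K : Fin r → Fin r → Matrix (Fin r × Fin n) (Fin r × Fin n) ℂ :=
    fun a b => Matrix.single a b (1 : ℂ) ⊗ₖ (1 : Matrix (Fin n) (Fin n) ℂ) with hK
  have hPt : IsUnit Pᵀ.det := by
    rw [Matrix.det_transpose]; exact (Matrix.isUnit_iff_isUnit_det P).mp hP
  have hQd : IsUnit Q.det := (Matrix.isUnit_iff_isUnit_det Q).mp hQ
  have hPtU : IsUnit Pᵀ := (Matrix.isUnit_iff_isUnit_det _).mpr hPt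
  have hPti : IsUnit Pᵀ⁻¹ := by
    rw [Matrix.isUnit_iff_isUnit_det]; exact Matrix.isUnit_nonsing_inv_det _ hPt
  have hQi : IsUnit Q⁻¹ := by
    rw [Matrix.isUnit_iff_isUnit_det]; exact Matrix.isUnit_nonsing_inv_det _ hQd
  -- the rectangle identity on Φ × Σ
  set Φ := LinearMap.ker (Matrix.mulVecLin G₀ᵀ) with hΦ
  set Sg := LinearMap.ker (Matrix.mulVecLin H₀ᵀ) with hSg
  have rect : ∀ φ ∈ Φ, ∀ s ∈ Sg, ∀ a b : Fin r,
      φ ⬝ᵥ ((P * K a b * Q) *ᵥ s) = (S *ᵥ φ) ⬝ᵥ ((P * K a b * Q) *ᵥ (S *ᵥ s)) := by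
    intro φ hφ s hs a b
    have hφ' : φ ᵥ* G₀ = 0 := by
      simpa [hΦ, LinearMap.mem_ker, Matrix.mulVecLin_apply, Matrix.mulVec_transpose] using hφ
    have hs' : s ᵥ* H₀ = 0 := by
      simpa [hSg, LinearMap.mem_ker, Matrix.mulVecLin_apply, Matrix.mulVec_transpose] using hs
    have h := congrArg (fun M => φ ⬝ᵥ (M *ᵥ s)) (hdisp a b)
    simp only [Matrix.sub_mulVec, Matrix.add_mulVec, dotProduct_sub, dotProduct_add] at h
    have h1 : φ ⬝ᵥ ((G₀ * (H₁ a b)ᵀ) *ᵥ s) = 0 := by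
      rw [← Matrix.mulVec_mulVec, Matrix.dotProduct_mulVec, hφ']; simp
    have h2 : φ ⬝ᵥ ((G₁ a b * H₀ᵀ) *ᵥ s) = 0 := by
      rw [← Matrix.mulVec_mulVec, Matrix.mulVec_transpose, hs']; simp
    rw [h1, h2, add_zero, sub_eq_zero] at h
    rw [h, ← Matrix.mulVec_mulVec, ← Matrix.mulVec_mulVec, Matrix.dotProduct_mulVec,
      Matrix.vecMul_transpose]
  -- the pairing in coordinates u = Pᵀ φ, v = Q s
  have pair : ∀ (φ s : Fin r × Fin n → ℂ) (a b : Fin r),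
      φ ⬝ᵥ ((P * K a b * Q) *ᵥ s) = ∑ i, (Pᵀ *ᵥ φ) (a, i) * (Q *ᵥ s) (b, i) := by
    intro φ s a b
    rw [← Matrix.mulVec_mulVec, ← Matrix.mulVec_mulVec, Matrix.dotProduct_mulVec,
      ← Matrix.mulVec_transpose, hK, kron_pairing]
  -- the data of the core lemma
  set A₁ : (Fin r × Fin n → ℂ) →ₗ[ℂ] (Fin r × Fin n → ℂ) := Matrix.toLin' (Pᵀ * S * Pᵀ⁻¹) with hA₁
  set A₂ : (Fin r × Fin n → ℂ) →ₗ[ℂ] (Fin r × Fin n → ℂ) := Matrix.toLin' (Q * S * Q⁻¹) with hA₂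
  set U := Φ.map (Matrix.toLin' Pᵀ) with hUdef
  set V := Sg.map (Matrix.toLin' Q) with hVdef
  have hU : r * n ≤ Module.finrank ℂ U + d := by
    have h1 := finrank_ker_transpose_ge d G₀
    rw [← hΦ] at h1
    have h2 : Module.finrank ℂ U = Module.finrank ℂ Φ := by
      apply LinearEquiv.finrank_eq
      refine (Submodule.equivMapOfInjective _ ?_ _).symm
      exact Matrix.mulVec_injective_iff_isUnit.mpr hPtU
    simp only [Fintype.card_prod, Fintype.card_fin] at h1
    omega
  have hV : r * n ≤ Module.finrank ℂ V + d := by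
    have h1 := finrank_ker_transpose_ge d H₀
    rw [← hSg] at h1
    have h2 : Module.finrank ℂ V = Module.finrank ℂ Sg := by
      apply LinearEquiv.finrank_eq
      refine (Submodule.equivMapOfInjective _ ?_ _).symm
      exact Matrix.mulVec_injective_iff_isUnit.mpr hQ
    simp only [Fintype.card_prod, Fintype.card_fin] at h1
    omega
  have hE : ∀ u ∈ U, ∀ v ∈ V, ∀ a b : Fin r,
      ∑ i, u (a, i) * v (b, i) = ∑ i, A₁ u (a, i) * A₂ v (b, i) := by
    rintro u ⟨φ, hφ, rfl⟩ v ⟨s, hs, rfl⟩ a b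
    have h := rect φ hφ s hs a b
    rw [pair, pair] at h
    have e1 : A₁ (Matrix.toLin' Pᵀ φ) = Pᵀ *ᵥ (S *ᵥ φ) := by
      rw [hA₁, Matrix.toLin'_apply, Matrix.toLin'_apply, Matrix.mulVec_mulVec, Matrix.mul_assoc,
        Matrix.mul_assoc, Matrix.nonsing_inv_mul _ hPt, Matrix.mul_one, ← Matrix.mulVec_mulVec]
    have e2 : A₂ (Matrix.toLin' Q s) = Q *ᵥ (S *ᵥ s) := by
      rw [hA₂, Matrix.toLin'_apply, Matrix.toLin'_apply, Matrix.mulVec_mulVec, Matrix.mul_assoc,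
        Matrix.mul_assoc, Matrix.nonsing_inv_mul _ hQd, Matrix.mul_one, ← Matrix.mulVec_mulVec]
    rw [e1, e2, Matrix.toLin'_apply, Matrix.toLin'_apply]
    exact h
  have hA₁k : Module.finrank ℂ (LinearMap.ker A₁) ≤ 1 := by
    -- w ↦ Pᵀ⁻¹ w maps ker A₁ injectively into ker S
    have hmem : ∀ w ∈ LinearMap.ker A₁, Matrix.toLin' Pᵀ⁻¹ w ∈
        LinearMap.ker (Matrix.toLin' S - (0 : ℂ) • (LinearMap.id : (Fin r × Fin n → ℂ) →ₗ[ℂ] _)) := by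
      intro w hw
      rw [LinearMap.mem_ker, hA₁, Matrix.toLin'_apply] at hw
      simp only [zero_smul, sub_zero, LinearMap.mem_ker, Matrix.toLin'_apply]
      have h0 : Pᵀ *ᵥ (S *ᵥ (Pᵀ⁻¹ *ᵥ w)) = Pᵀ *ᵥ 0 := by
        rw [Matrix.mulVec_mulVec, Matrix.mulVec_mulVec, Matrix.mulVec_zero]; exact hw
      exact Matrix.mulVec_injective_iff_isUnit.mpr hPtU h0
    have hinj : Function.Injective ((Matrix.toLin' Pᵀ⁻¹).restrict hmem) := by
      intro w w' h
      apply Subtype.ext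
      have h' := congrArg Subtype.val h
      simp only [LinearMap.coe_restrict_apply, Matrix.toLin'_apply] at h'
      exact Matrix.mulVec_injective_iff_isUnit.mpr hPti h'
    exact (LinearMap.finrank_le_finrank_of_injective hinj).trans (hS 0)
  have hA₂e : ∀ (μ : ℂ) (W : Submodule ℂ (Fin r × Fin n → ℂ)),
      (∀ w ∈ W, A₂ w = μ • w) → Module.finrank ℂ W ≤ 1 := by
    intro μ W hW
    have hmem : ∀ w ∈ W, Matrix.toLin' Q⁻¹ w ∈
        LinearMap.ker (Matrix.toLin' S - μ • (LinearMap.id : (Fin r × Fin n → ℂ) →ₗ[ℂ] _)) := by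
      intro w hw
      have h := hW w hw
      rw [hA₂, Matrix.toLin'_apply] at h
      simp only [LinearMap.mem_ker, LinearMap.sub_apply, LinearMap.smul_apply, LinearMap.id_apply,
        Matrix.toLin'_apply, sub_eq_zero]
      apply Matrix.mulVec_injective_iff_isUnit.mpr hQ
      show Q *ᵥ (S *ᵥ (Q⁻¹ *ᵥ w)) = Q *ᵥ (μ • (Q⁻¹ *ᵥ w))
      rw [Matrix.mulVec_mulVec, Matrix.mulVec_mulVec, h, Matrix.mulVec_smul, Matrix.mulVec_mulVec,
        Matrix.mul_nonsing_inv _ hQd, Matrix.one_mulVec]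
    have hinj : Function.Injective ((Matrix.toLin' Q⁻¹).restrict hmem) := by
      intro w w' h
      apply Subtype.ext
      have h' := congrArg Subtype.val h
      simp only [LinearMap.coe_restrict_apply, Matrix.toLin'_apply] at h'
      exact Matrix.mulVec_injective_iff_isUnit.mpr hQi h'
    exact (LinearMap.finrank_le_finrank_of_injective hinj).trans (hS μ)
  exact core d hn A₁ A₂ hA₁k hA₂e U V hU hV hE



/-- The crux's transposed lower shift acts by `(Zᵀ v)_i = v_{i+1}` (and `0` in the last coordinate). -/
theorem shiftZ_transpose_mulVec {N : ℕ} (v : Fin N → ℂ) (i : Fin N) :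
    ((Matrix.of fun i j : Fin N => if (i : ℕ) = (j : ℕ) + 1 then (1 : ℂ) else 0)ᵀ *ᵥ v) i = if h : (i : ℕ) + 1 < N then v ⟨(i : ℕ) + 1, h⟩ else 0 := by
  simp only [Matrix.mulVec, dotProduct, Matrix.transpose_apply, Matrix.of_apply]
  split_ifs with h
  · rw [Finset.sum_eq_single ⟨(i : ℕ) + 1, h⟩]
    · simp
    · intro j _ hj
      have : ¬ ((j : ℕ) = (i : ℕ) + 1) := by
        intro hji; apply hj; ext; simpa using hji
      simp [this]
    · simp
  · apply Finset.sum_eq_zero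
    intro j _
    have : ¬ ((j : ℕ) = (i : ℕ) + 1) := by
      intro hji; apply h; rw [← hji]; exact j.2
    simp [this]

/-- Every eigenspace of `Zᵀ` is at most one-dimensional: a solution of `Zᵀ v = μ v` is determined by `v 0`. -/
theorem finrank_eigenspace_shiftZT_le_one (N : ℕ) (μ : ℂ) :
    Module.finrank ℂ (LinearMap.ker (Matrix.toLin' (Matrix.of fun i j : Fin N => if (i : ℕ) = (j : ℕ) + 1 then (1 : ℂ) else 0)ᵀ -
      μ • (LinearMap.id : (Fin N → ℂ) →ₗ[ℂ] (Fin N → ℂ)))) ≤ 1 := by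
  rcases Nat.eq_zero_or_pos N with hN | hN
  · subst hN
    have : Module.finrank ℂ (Fin 0 → ℂ) = 0 := by simp
    calc Module.finrank ℂ _ ≤ Module.finrank ℂ (Fin 0 → ℂ) := Submodule.finrank_le _
      _ ≤ 1 := by omega
  set Kμ := LinearMap.ker (Matrix.toLin' (Matrix.of fun i j : Fin N => if (i : ℕ) = (j : ℕ) + 1 then (1 : ℂ) else 0)ᵀ -
      μ • (LinearMap.id : (Fin N → ℂ) →ₗ[ℂ] (Fin N → ℂ))) with hKμ
  -- the functional v ↦ v 0 is injective on Kμ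
  have key : ∀ v ∈ Kμ, v ⟨0, hN⟩ = 0 → v = 0 := by
    intro v hv h0
    have hv' : ∀ i : Fin N, ((Matrix.of fun i j : Fin N => if (i : ℕ) = (j : ℕ) + 1 then (1 : ℂ) else 0)ᵀ *ᵥ v) i = μ * v i := by
      intro i
      have := congrFun (show ((Matrix.of fun i j : Fin N => if (i : ℕ) = (j : ℕ) + 1 then (1 : ℂ) else 0)ᵀ *ᵥ v) - μ • v = 0 by
        simpa [hKμ, LinearMap.mem_ker, Matrix.toLin'_apply] using hv) i
      simpa [sub_eq_zero] using this
    have step : ∀ k : ℕ, ∀ hk : k < N, v ⟨k, hk⟩ = 0 := by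
      intro k
      induction k with
      | zero => intro hk; exact h0
      | succ k ih =>
        intro hk
        have hk' : k < N := by omega
        have h := hv' ⟨k, hk'⟩
        rw [shiftZ_transpose_mulVec] at h
        simp only [hk, dif_pos] at h
        rw [h, ih hk', mul_zero]
    ext ⟨k, hk⟩
    exact step k hk
  let f : Kμ →ₗ[ℂ] ℂ :=
    { toFun := fun v => (v : Fin N → ℂ) ⟨0, hN⟩
      map_add' := fun v w => rfl
      map_smul' := fun c v => rfl }
  have hf : Function.Injective f := by
    intro v w h
    apply Subtype.ext
    have := key (v - w) (Kμ.sub_mem v.2 w.2) (by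
      have h' : (v : Fin N → ℂ) ⟨0, hN⟩ = (w : Fin N → ℂ) ⟨0, hN⟩ := h
      simp [h'])
    exact sub_eq_zero.mp this
  have := LinearMap.finrank_le_finrank_of_injective hf
  simpa using this


/-- **Theorem 1 in the crux's literal form.**  For every presentation `Fin r × Fin n ≃ Fin N` and all invertible
`P Q`, if the Kronecker pencil `T_ab = P (E_ab ⊗ 1ₙ) Q` satisfies the crux's split Stein identity
`T_ab − Z T_ab Zᵀ = G₀ H₁(ab)ᵀ + G₁(ab) H₀ᵀ` with generators of width `d`, then `r ≤ d + 1`. -/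
theorem kroneckerPencil_crux_le_width_succ (r n N d : ℕ) (hn : 1 ≤ n) (e : Fin r × Fin n ≃ Fin N)
    (P Q : Matrix (Fin N) (Fin N) ℂ) (hP : IsUnit P) (hQ : IsUnit Q)
    (G₀ H₀ : Matrix (Fin N) (Fin d) ℂ) (G₁ H₁ : Fin r → Fin r → Matrix (Fin N) (Fin d) ℂ)
    (hdisp : ∀ a b : Fin r,
      P * Matrix.reindex e e (Matrix.single a b (1 : ℂ) ⊗ₖ (1 : Matrix (Fin n) (Fin n) ℂ)) * Q
        - (Matrix.of fun i j : Fin N => if (i : ℕ) = (j : ℕ) + 1 then (1 : ℂ) else 0) * (P * Matrix.reindex e e (Matrix.single a b (1 : ℂ) ⊗ₖ (1 : Matrix (Fin n) (Fin n) ℂ)) * Q)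
          * (Matrix.of fun i j : Fin N => if (i : ℕ) = (j : ℕ) + 1 then (1 : ℂ) else 0)ᵀ
        = G₀ * (H₁ a b)ᵀ + G₁ a b * H₀ᵀ) :
    r ≤ d + 1 := by
  classical
  set S : Matrix (Fin r × Fin n) (Fin r × Fin n) ℂ := ((Matrix.of fun i j : Fin N => if (i : ℕ) = (j : ℕ) + 1 then (1 : ℂ) else 0)ᵀ).submatrix e e with hSdef
  have hP' : IsUnit (P.submatrix e e) := by
    rw [Matrix.isUnit_iff_isUnit_det, Matrix.det_submatrix_equiv_self]
    exact (Matrix.isUnit_iff_isUnit_det P).mp hP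
  have hQ' : IsUnit (Q.submatrix e e) := by
    rw [Matrix.isUnit_iff_isUnit_det, Matrix.det_submatrix_equiv_self]
    exact (Matrix.isUnit_iff_isUnit_det Q).mp hQ
  -- eigenspaces of the reindexed `Zᵀ` are at most one-dimensional
  have hS : ∀ μ : ℂ, Module.finrank ℂ
      (LinearMap.ker (Matrix.toLin' S - μ • (LinearMap.id : (Fin r × Fin n → ℂ) →ₗ[ℂ] _))) ≤ 1 := by
    intro μ
    set K0 := LinearMap.ker (Matrix.toLin' (Matrix.of fun i j : Fin N => if (i : ℕ) = (j : ℕ) + 1 then (1 : ℂ) else 0)ᵀ -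
      μ • (LinearMap.id : (Fin N → ℂ) →ₗ[ℂ] (Fin N → ℂ))) with hK0
    have hle : LinearMap.ker (Matrix.toLin' S - μ • (LinearMap.id : (Fin r × Fin n → ℂ) →ₗ[ℂ] _))
        ≤ K0.map ((LinearEquiv.funCongrLeft ℂ ℂ e : (Fin N → ℂ) ≃ₗ[ℂ] (Fin r × Fin n → ℂ)) :
          (Fin N → ℂ) →ₗ[ℂ] (Fin r × Fin n → ℂ)) := by
      intro w hw
      simp only [LinearMap.mem_ker, LinearMap.sub_apply, LinearMap.smul_apply, LinearMap.id_apply,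
        Matrix.toLin'_apply, sub_eq_zero, hSdef, Matrix.submatrix_mulVec_equiv] at hw
      refine ⟨w ∘ e.symm, ?_, ?_⟩
      · rw [hK0]
        simp only [SetLike.mem_coe, LinearMap.mem_ker, LinearMap.sub_apply, LinearMap.smul_apply,
          LinearMap.id_apply, Matrix.toLin'_apply, sub_eq_zero]
        ext j
        have := congrFun hw (e.symm j)
        simpa using this
      · rw [LinearEquiv.coe_coe, LinearEquiv.funCongrLeft_apply]
        ext p
        rw [LinearMap.funLeft_apply, Function.comp_apply, Equiv.symm_apply_apply]
    calc Module.finrank ℂ _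
        ≤ Module.finrank ℂ (K0.map ((LinearEquiv.funCongrLeft ℂ ℂ e :
            (Fin N → ℂ) ≃ₗ[ℂ] (Fin r × Fin n → ℂ)) : (Fin N → ℂ) →ₗ[ℂ] (Fin r × Fin n → ℂ))) :=
          Submodule.finrank_mono hle
      _ = Module.finrank ℂ K0 := LinearEquiv.finrank_map_eq _ K0
      _ ≤ 1 := finrank_eigenspace_shiftZT_le_one N μ
  -- transport the displacement identity along `e`
  have hdisp' : ∀ a b : Fin r,
      P.submatrix e e * (Matrix.single a b (1 : ℂ) ⊗ₖ (1 : Matrix (Fin n) (Fin n) ℂ)) * Q.submatrix e e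
        - Sᵀ * (P.submatrix e e * (Matrix.single a b (1 : ℂ) ⊗ₖ (1 : Matrix (Fin n) (Fin n) ℂ))
            * Q.submatrix e e) * S
        = G₀.submatrix e id * ((H₁ a b).submatrix e id)ᵀ + (G₁ a b).submatrix e id * (H₀.submatrix e id)ᵀ := by
    intro a b
    have h := congrArg (fun M : Matrix (Fin N) (Fin N) ℂ => M.submatrix e e) (hdisp a b)
    simp only [Matrix.submatrix_sub, Matrix.submatrix_add, Pi.sub_apply, Pi.add_apply] at h
    have hT : (P * Matrix.reindex e e (Matrix.single a b (1 : ℂ) ⊗ₖ (1 : Matrix (Fin n) (Fin n) ℂ)) * Q).submatrix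
        e e = P.submatrix e e * (Matrix.single a b (1 : ℂ) ⊗ₖ (1 : Matrix (Fin n) (Fin n) ℂ)) * Q.submatrix e e := by
      rw [← Matrix.submatrix_mul_equiv _ Q e e e, ← Matrix.submatrix_mul_equiv P _ e e e,
        Matrix.reindex_apply, Matrix.submatrix_submatrix, Equiv.symm_comp_self, Matrix.submatrix_id_id]
    rw [← Matrix.submatrix_mul_equiv _ ((Matrix.of fun i j : Fin N => if (i : ℕ) = (j : ℕ) + 1 then (1 : ℂ) else 0)ᵀ) e e e, ← Matrix.submatrix_mul_equiv ((Matrix.of fun i j : Fin N => if (i : ℕ) = (j : ℕ) + 1 then (1 : ℂ) else 0)) _ e e e,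
      hT, ← Matrix.submatrix_mul_equiv G₀ _ e (Equiv.refl _) e,
      ← Matrix.submatrix_mul_equiv (G₁ a b) _ e (Equiv.refl _) e] at h
    have hZ : ((Matrix.of fun i j : Fin N => if (i : ℕ) = (j : ℕ) + 1 then (1 : ℂ) else 0)).submatrix e e = Sᵀ := by
      rw [hSdef, Matrix.transpose_submatrix, Matrix.transpose_transpose]
    rw [hZ] at h
    simpa [Matrix.transpose_submatrix] using h
  exact kroneckerPencil_le_width_succ d hn (P.submatrix e e) (Q.submatrix e e) S hP' hQ' hS
    (G₀.submatrix e id) (H₀.submatrix e id) (fun a b => (G₁ a b).submatrix e id)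
    (fun a b => (H₁ a b).submatrix e id) hdisp'


end Summit.MatrixMultiplication.MatrixMultiplication.Theorems.KroneckerNeutral
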